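import Literature.NumberTheory.Rogawski1990.CurveThetaHodgeTypeSigned
import Literature.NumberTheory.Automorphic.UnitaryCurveCohCotangentFormsConjRep
import Literature.NumberTheory.Automorphic.IdeleClassCharacterConjugate
import Literature.NumberTheory.Automorphic.Liu2021.RemD5CompanionAdmissibility
import Literature.NumberTheory.Automorphic.Liu2021.Def411AdmissibleRescaling
import Literature.NumberTheory.Automorphic.Liu2021.Def411ChiGaloisTwist
import HarnessLib

/-!
# E3₂: the ANTIHOLOMORPHIC signed Hodge-type rule follows from the HOLOMORPHIC one by complex conjugation,
# given the conjugate partner of the oscillator carrier at the mirror line `⟨−a⟩`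

Cell `hodgecm-mathlib`, floor 0, programme P5 (`Cruxes/HLiu418/Lines/F0_AlbCm.lean`, stub `stub_S1b_facts`), crux item
`stmt-HodgeConjecture-24832` (`HCCMUnconditional.HLiu418`).  THEOREMS ONLY (no definition, no named fact, no instance, no `sorry`).

The two printed-citation named facts ★ `Rogawski1990.curveThetaHodgeTypeSigned_hol` ∕ `_antihol` ([Liu2021, Rem. D.5], the two
halves of the signed Hodge-type rule for theta finite components on the unitary Shimura CURVES) are exchanged by complex conjugation:
`P ↦ P̄` flips the Hodge type (★ `isAntiholCotangentAt₂_iff_conj`), `σ ↦ σ̄ = repConj σ` keeps irreducibility ∕ smoothness and the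
finite-component relation (★ `hasFinComponent_conj_repConj`), the label `λ ↦ λᶜ = λ ∘ c` stays conjugate symplectic of weight one with
`Φ_{λᶜ} = Φ̄_λ` (★ `IsConjugateSymplectic.cmType_galConj`), and [Liu2021, Def. 4.12, last sentence] «`ε` is `μ`-admissible iff `−ε` is
`μᶜ`-admissible» reads, at the mirror representative `−a` of `−ε`, `(∃ e Φ̄-admissible, ε(e) = ε(−a)) ↔ (∃ e Φ-admissible, ε(e) = ε(a))`
(★ `exists_isAdmissibleElement_neg_iff_bar`, ★ `epsOf_algebraMap_mul_eq_locF_mul_of_complexConj_eq_neg`).  The one analytic input is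
the CONJUGATE PARTNER of the oscillator carrier — a bijective conjugate-linear `U(J_V)(𝔸_f)`-map
`J : ω(λ, ⟨a⟩, χ) → ω(λ′, ⟨−a⟩, χ̄)` with `Φ_{λ′} = Φ̄_λ` ([Liu2021, App. D Lem. D.1 (2)] «`\overline{ω(μ,ε,χ)} ≅ ω(μᶜ, −ε, χ⁻¹)`»; rank 3: ★
`H413MirrorAtPinLine.exists_conjPartner_omegaAtLine_neg`) — taken here as the displayed HYPOTHESIS `hO` (rank 2, the E3 letters' currency
`isCompatible_chiSplittingLine … (toHeckeCharacter L λ) …`), to be discharged by the sequel files of this seat: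

* §1 `exists_isAdmissibleElement_bar_locF_neg_iff` — the admissibility flip at `⟨−a⟩`;
* §2 **`curveThetaHodgeTypeSigned_antihol_of_hol_of_conjPartner`** — `hO → curveThetaHodgeTypeSigned_hol → curveThetaHodgeTypeSigned_antihol`:
  given antiholomorphic data `(λ, a, χ, σ, j, P)`, apply the holomorphic rule to `(λ′, −a, χ̄, σ̄, J ∘ j ∘ toConj⁻¹, P̄)` and flip.

HC_CM is proved only modulo the 7 printed citations (+ the declared floor-0 debt) until rung 0 closes; this file discharges none of them by itself
(it makes `_antihol` a consequence of `_hol` once `hO` is a theorem).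

## References
* [Liu2021] Y. Liu, *Fourier–Jacobi cycles and arithmetic relative trace formula*, Camb. J. Math. 9 (2021) = arXiv:2102.11518: Def. 4.12 (last
  sentence), Rem. 4.4, App. D Lem. D.1 (2), Rem. D.5, proof of Thm. D.6 (1).
* [BorelWallach2000] A. Borel, N. Wallach, *Continuous cohomology, discrete subgroups, and representations of reductive groups*, 2nd ed., VII 2.10.
* [Li1992] J.-S. Li, J. reine angew. Math. 428 (1992), p. 181 (`ω*` is `ω_{ψ̄}`).
-/

set_option autoImplicit false
set_option linter.dupNamespace false

noncomputable section

open NumberField NumberField.InfinitePlace MeasureTheory IsDedekindDomain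
open scoped Matrix ComplexOrder

namespace Summit.HodgeConjecture.HodgeConjecture.Cruxes.HLiu418.E3AntiholOfHol

open Literature.NumberTheory.Automorphic Literature.NumberTheory.Automorphic.UnitaryGroup
open Literature.NumberTheory.Automorphic.UnitaryGroup.CotangentForms (toQuotFun hasFinComponent_conj_repConj)
open Literature.NumberTheory.Automorphic.UnitaryCurveForms
open Literature.NumberTheory.Automorphic.ConjVec
open Literature.NumberTheory.Automorphic.Liu2021 Literature.NumberTheory.Automorphic.Liu2021.Def411WeilCarriers
open Literature.NumberTheory.Automorphic.Liu2021.Def411WeilCarriersDoubling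
open Literature.NumberTheory.GaloisRepresentations Literature.NumberTheory.Automorphic.IdeleClassGroup
open Literature.AlgebraicGeometry.Liu2021 (IsAdmissibleElement isAdmissibleElement_conj_neg_iff)
open Literature.NumberTheory.GelbartRogawski1991 Literature.NumberTheory.GelbartRogawski1991.UnitaryDualPair
open Literature.RepresentationTheory.Liu2021 Literature.RepresentationTheory.HarrisKudlaSweet1996
open Literature.NumberTheory.ComplexMultiplication (CMTypeOps.bar CMTypeOps.mem_bar_iff)
open Literature.NumberTheory.Rogawski1990 (curveThetaHodgeTypeSigned_hol curveThetaHodgeTypeSigned_antihol)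

/-! ## §1 The admissibility flip at the mirror representative `−a` -/

section Flip

variable {L : Type} [Field L] [NumberField L] [IsCMField L]

/-- `ε(−e) = ε(−1)·ε(e)` for `e ∈ L^{×−}`. [cite: Liu2021, Def. 4.12 (l. 2105)] -/
theorem epsOf_neg {e : L} (he : IsCMField.complexConj L e = -e) (he0 : e ≠ 0) :
    epsOf (↥(maximalRealSubfield L)) (imagUnitSq L) L (2 * imagUnit L)⁻¹ (-e) =
      locF (↥(maximalRealSubfield L)) (imagUnitSq L) (-1) * epsOf (↥(maximalRealSubfield L)) (imagUnitSq L) L (2 * imagUnit L)⁻¹ e := by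
  have h1 : algebraMap (↥(maximalRealSubfield L)) L ((-1 : (↥(maximalRealSubfield L))ˣ) : ↥(maximalRealSubfield L)) * e = -e := by
    rw [Units.val_neg, Units.val_one, map_neg, map_one, neg_one_mul]
  -- the normaliser `(2δ_L)⁻¹` of the collections is purely imaginary and non-zero (cf. ★ `H413ThetaPinBridge.complexConj_two_mul_imagUnit_inv`)
  have hδ : IsCMField.complexConj L (2 * imagUnit L)⁻¹ = -(2 * imagUnit L)⁻¹ := by
    rw [map_inv₀, map_mul, map_ofNat, complexConj_imagUnit, mul_neg, inv_neg]
  have hδ0 : (2 * imagUnit L)⁻¹ ≠ (0 : L) := inv_ne_zero (mul_ne_zero two_ne_zero (imagUnit_ne_zero L))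
  have h2 := epsOf_algebraMap_mul_eq_locF_mul_of_complexConj_eq_neg (imagUnitSq L) hδ hδ0 he he0 (-1)
  rw [h1] at h2
  exact h2

/-- **the collection of `−e` is the collection of the line `⟨−a⟩` iff the collection of `e` is that of `⟨a⟩`** (`e ∈ L^{×−}`):
`ε(−e) = ε(−1)·ε(e)`, `ε(−a) = ε(−1)·ε(a)`. [cite: Liu2021, Def. 4.12 (l. 2105)] -/
theorem epsOf_neg_eq_locF_neg_iff {e : L} (he : IsCMField.complexConj L e = -e) (he0 : e ≠ 0)
    (a : (↥(maximalRealSubfield L))ˣ) :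
    epsOf (↥(maximalRealSubfield L)) (imagUnitSq L) L (2 * imagUnit L)⁻¹ (-e) =
        locF (↥(maximalRealSubfield L)) (imagUnitSq L) (-a) ↔
      epsOf (↥(maximalRealSubfield L)) (imagUnitSq L) L (2 * imagUnit L)⁻¹ e = locF (↥(maximalRealSubfield L)) (imagUnitSq L) a := by
  constructor
  · intro h
    have h' := epsOf_neg (e := -e) (by rw [map_neg, he, neg_neg]) (neg_ne_zero.2 he0)
    rw [neg_neg, h, ← map_mul, neg_one_mul, neg_neg] at h'
    exact h'
  · intro h
    rw [epsOf_neg he he0, h, ← map_mul, neg_one_mul]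

/-- **THE ADMISSIBILITY FLIP** ([Liu2021, Def. 4.12, last sentence] «`ε` is `μ`-admissible iff `−ε` is `μᶜ`-admissible», `Φ_{μᶜ} = Φ̄_μ`),
at the mirror representative: some `Φ̄`-admissible element has the collection of `⟨−a⟩` iff some `Φ`-admissible element has the
collection of `⟨a⟩` (substitute `e ↦ −e`). [cite: Liu2021, Def. 4.12 (l. 2102–2108); Rem. 4.4] -/
theorem exists_isAdmissibleElement_bar_locF_neg_iff (Φ : Literature.AlgebraicGeometry.Motives.CMType L)
    (a : (↥(maximalRealSubfield L))ˣ) :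
    (∃ e : L, IsAdmissibleElement L (CMTypeOps.bar Φ).1 e ∧
        epsOf (↥(maximalRealSubfield L)) (imagUnitSq L) L (2 * imagUnit L)⁻¹ e =
          locF (↥(maximalRealSubfield L)) (imagUnitSq L) (-a)) ↔
      ∃ e : L, IsAdmissibleElement L Φ.1 e ∧
        epsOf (↥(maximalRealSubfield L)) (imagUnitSq L) L (2 * imagUnit L)⁻¹ e = locF (↥(maximalRealSubfield L)) (imagUnitSq L) a := by
  rw [← RemD5.exists_isAdmissibleElement_neg_iff_bar]
  refine exists_congr fun e => and_congr_right fun he => ?_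
  exact epsOf_neg_eq_locF_neg_iff he.2.1 he.1 a

end Flip

/-! ## §2 `curveThetaHodgeTypeSigned_antihol` from `curveThetaHodgeTypeSigned_hol` and the conjugate partner -/

section Main

set_option maxHeartbeats 4000000 in
-- (two instances of the E3 letter telescope and the conjugate-partner telescope are elaborated and matched)
/-- **E3₂-antihol ⟸ E3₂-hol + the conjugate partner at the mirror line.**  HYPOTHESIS `hO` (rank 2, the letters' currency): for every
`λ` conjugate symplectic of weight one, unit `a ∈ (L⁺)ˣ` and `χ ∈ Chi`, some `λ′` conjugate symplectic of weight one with `Φ_{λ′} = Φ̄_λ` and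
a BIJECTIVE conjugate-linear `J : ω(λ, ⟨a⟩, χ) → ω(λ′, ⟨−a⟩, χ̄)` with `J ∘ rhoVAtLine a χ k = rhoVAtLine (−a) χ̄ k ∘ J` for all
`k ∈ U(diag dV)(𝔸_f)` ([Liu2021, App. D Lem. D.1 (2)]).  PROOF: given antiholomorphic data `(λ, a, χ, W, σ, j, P)` — `P̄` is holomorphic
(★ `isAntiholCotangentAt₂_iff_conj`) with finite component `σ̄ = repConj σ` (★ `hasFinComponent_conj_repConj`), irreducible and smooth
(★ `isIrreducible_repConj_iff`, `isSmooth_repConj_iff`); `J ∘ j ∘ toConj⁻¹ : σ̄ → ω(λ′, ⟨−a⟩, χ̄) ∘ (finAdelicCongr …)⁻¹` is a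
complex-linear injective intertwiner; the holomorphic rule there gives `e♮ ∈ Φ_{λ′} ↔ ∃ e Φ_{λ′}-admissible, ε(e) = ε(−a)`, i.e.
(`Φ_{λ′} = Φ̄_λ`, §1) `e♮ ∉ Φ_λ ↔ ∃ e Φ_λ-admissible, ε(e) = ε(a)` — the antiholomorphic rule.
[cite: Liu2021, App. D Rem. D.5 (p. 131); Lem. D.1 (2) (l. 5231); Def. 4.12; Rem. 4.4; proof of Thm. D.6 (1)] [cite: BorelWallach2000, VII 2.10]
[cite: Li1992, p. 181] -/
theorem curveThetaHodgeTypeSigned_antihol_of_hol_of_conjPartner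
    (hO : ∀ (L : Type) [Field L] [NumberField L] [IsCMField L]
      (dV : Fin 2 → L) (hdV : ∀ i, IsCMField.complexConj L (dV i) = dV i) (hdV0 : ∀ i, dV i ≠ 0)
      {n' : ℕ} (e₁ : Fin 2 × Fin 1 ≃ Fin n')
      (lam : Literature.NumberTheory.Automorphic.IdeleClassGroup L →ₜ* Circle) (hlam : IsConjugateSymplectic L lam),
      HasWeight L lam 1 →
      ∀ (a : (↥(maximalRealSubfield L))ˣ) (χ : Chi (↥(maximalRealSubfield L)) L (IsCMField.complexConj L)),
      ∃ (lam' : Literature.NumberTheory.Automorphic.IdeleClassGroup L →ₜ* Circle) (hlam' : IsConjugateSymplectic L lam'),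
        HasWeight L lam' 1 ∧ hlam'.cmType = CMTypeOps.bar hlam.cmType ∧
        ∃ J : omegaAtLine (↥(maximalRealSubfield L)) L (IsCMField.complexConj L) 2 e₁ (Matrix.diagonal dV)
              (complexConj_imagUnit L) (imagUnit_ne_zero L) (imagUnit_mul_self L) (realDiagonal_isSymm L dV hdV)
              (isUnit_det_realDiagonal L dV hdV hdV0) (realDiagonal_map L dV hdV).symm
              (fun a => isCompatible_chiSplittingLine L e₁ dV hdV hdV0 (toHeckeCharacter L lam)
                (isUnitary_toHeckeCharacter L lam) ((isOscillatorChar_toHeckeCharacter_iff lam).mpr hlam)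
                (TW (↥(maximalRealSubfield L)) a) (isSymm_TW (↥(maximalRealSubfield L)) a)
                (isUnit_det_TW (↥(maximalRealSubfield L)) a) (JW (↥(maximalRealSubfield L)) L a)
                (JW_eq (↥(maximalRealSubfield L)) L a)) a χ →ₛₗ[starRingEnd ℂ]
            omegaAtLine (↥(maximalRealSubfield L)) L (IsCMField.complexConj L) 2 e₁ (Matrix.diagonal dV)
              (complexConj_imagUnit L) (imagUnit_ne_zero L) (imagUnit_mul_self L) (realDiagonal_isSymm L dV hdV)
              (isUnit_det_realDiagonal L dV hdV hdV0) (realDiagonal_map L dV hdV).symm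
              (fun a => isCompatible_chiSplittingLine L e₁ dV hdV hdV0 (toHeckeCharacter L lam')
                (isUnitary_toHeckeCharacter L lam') ((isOscillatorChar_toHeckeCharacter_iff lam').mpr hlam')
                (TW (↥(maximalRealSubfield L)) a) (isSymm_TW (↥(maximalRealSubfield L)) a)
                (isUnit_det_TW (↥(maximalRealSubfield L)) a) (JW (↥(maximalRealSubfield L)) L a)
                (JW_eq (↥(maximalRealSubfield L)) L a)) (-a)
              ⟨(Units.map ((starRingEnd ℂ : ℂ →+* ℂ) : ℂ →* ℂ)).comp χ.1,
                isAutomorphicOneChar_unitsMap_comp_chi (IsCMField.complexConj L) χ _⟩,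
          Function.Bijective J ∧
          ∀ (k : finAdelic (↥(maximalRealSubfield L)) L (IsCMField.complexConj L) 2 (Matrix.diagonal dV)) x,
            J (rhoVAtLine (↥(maximalRealSubfield L)) L (IsCMField.complexConj L) 2 e₁ (Matrix.diagonal dV)
                (complexConj_imagUnit L) (imagUnit_ne_zero L) (imagUnit_mul_self L) (realDiagonal_isSymm L dV hdV)
                (isUnit_det_realDiagonal L dV hdV hdV0) (realDiagonal_map L dV hdV).symm
                (fun a => isCompatible_chiSplittingLine L e₁ dV hdV hdV0 (toHeckeCharacter L lam)
                  (isUnitary_toHeckeCharacter L lam) ((isOscillatorChar_toHeckeCharacter_iff lam).mpr hlam)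
                  (TW (↥(maximalRealSubfield L)) a) (isSymm_TW (↥(maximalRealSubfield L)) a)
                  (isUnit_det_TW (↥(maximalRealSubfield L)) a) (JW (↥(maximalRealSubfield L)) L a)
                  (JW_eq (↥(maximalRealSubfield L)) L a)) a χ k x) =
              rhoVAtLine (↥(maximalRealSubfield L)) L (IsCMField.complexConj L) 2 e₁ (Matrix.diagonal dV)
                (complexConj_imagUnit L) (imagUnit_ne_zero L) (imagUnit_mul_self L) (realDiagonal_isSymm L dV hdV)
                (isUnit_det_realDiagonal L dV hdV hdV0) (realDiagonal_map L dV hdV).symm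
                (fun a => isCompatible_chiSplittingLine L e₁ dV hdV hdV0 (toHeckeCharacter L lam')
                  (isUnitary_toHeckeCharacter L lam') ((isOscillatorChar_toHeckeCharacter_iff lam').mpr hlam')
                  (TW (↥(maximalRealSubfield L)) a) (isSymm_TW (↥(maximalRealSubfield L)) a)
                  (isUnit_det_TW (↥(maximalRealSubfield L)) a) (JW (↥(maximalRealSubfield L)) L a)
                  (JW_eq (↥(maximalRealSubfield L)) L a)) (-a)
                ⟨(Units.map ((starRingEnd ℂ : ℂ →+* ℂ) : ℂ →* ℂ)).comp χ.1,
                  isAutomorphicOneChar_unitsMap_comp_chi (IsCMField.complexConj L) χ _⟩ k (J x))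
    (hE3 : curveThetaHodgeTypeSigned_hol) : curveThetaHodgeTypeSigned_antihol := by
  intro L _ _ _ ι H dV hdV hdV0 t ht g hg hsig hpos h4 𝔣 μ _ n' e₁ lam hlam hw a χ W _ _ σ hirr hsm j hj P hP hPσ
  -- the conjugate partner at `(λ, a, χ)`
  obtain ⟨lam', hlam', hw', hΦ', J, hJb, hJ⟩ := hO L dV hdV hdV0 e₁ lam hlam hw a χ
  -- the conjugate data: `P̄` holomorphic with finite component `σ̄`
  have hP' : P.conj.IsHolCotangentAt₂ (IsCMField.complexConj_ne_one L) (UnitaryGroup.complexConj_smul_infinitePlace L)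
      (cmPlace L ι) 𝔣 := (isAntiholCotangentAt₂_iff_conj _ _ _ P 𝔣).mp hP
  have hPσ' : P.conj.HasFinComponent (repConj σ) := hasFinComponent_conj_repConj P hPσ
  have hirr' : (repConj σ).IsIrreducible := (isIrreducible_repConj_iff σ).mpr hirr
  have hsm' : (repConj σ).IsSmooth := (isSmooth_repConj_iff σ).mpr hsm
  -- the conjugate intertwiner `J ∘ j ∘ toConj⁻¹`, complex-linear and injective
  let j'ₗ := (J : _ →ₛₗ[starRingEnd ℂ] _).comp (j.toLinearMap.comp ((toConj (V := W)).symm : ConjVec W →ₛₗ[starRingEnd ℂ] W))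
  have hj'ₗ : ∀ w : ConjVec W, j'ₗ w = J (j ((toConj (V := W)).symm w)) := fun _ => rfl
  let j' := LinearMap.intertwiningMap_of_isIntertwiningMap (repConj σ)
    ((rhoVAtLine (↥(maximalRealSubfield L)) L (IsCMField.complexConj L) 2 e₁ (Matrix.diagonal dV)
        (complexConj_imagUnit L) (imagUnit_ne_zero L) (imagUnit_mul_self L) (realDiagonal_isSymm L dV hdV)
        (isUnit_det_realDiagonal L dV hdV hdV0) (realDiagonal_map L dV hdV).symm
        (fun a => isCompatible_chiSplittingLine L e₁ dV hdV hdV0 (toHeckeCharacter L lam')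
          (isUnitary_toHeckeCharacter L lam') ((isOscillatorChar_toHeckeCharacter_iff lam').mpr hlam')
          (TW (↥(maximalRealSubfield L)) a) (isSymm_TW (↥(maximalRealSubfield L)) a)
          (isUnit_det_TW (↥(maximalRealSubfield L)) a) (JW (↥(maximalRealSubfield L)) L a)
          (JW_eq (↥(maximalRealSubfield L)) L a)) (-a)
        ⟨(Units.map ((starRingEnd ℂ : ℂ →+* ℂ) : ℂ →* ℂ)).comp χ.1,
          isAutomorphicOneChar_unitsMap_comp_chi (IsCMField.complexConj L) χ _⟩).comp
      (finAdelicCongr (↥(maximalRealSubfield L)) L (IsCMField.complexConj L) g ht hg).symm.toMonoidHom)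
    j'ₗ (fun k w => by
      rw [hj'ₗ, hj'ₗ, repConj_apply, LinearEquiv.symm_apply_apply,
        Representation.IntertwiningMap.isIntertwining σ _ j k, MonoidHom.comp_apply, MonoidHom.comp_apply]
      exact hJ _ _)
  have hj'app : ∀ w : ConjVec W, j' w = J (j ((toConj (V := W)).symm w)) := fun _ => rfl
  have hj' : Function.Injective j' := fun w w' hww' => by
    rw [hj'app, hj'app] at hww'
    exact (toConj (V := W)).symm.injective (hj (hJb.1 hww'))
  -- the holomorphic rule at the conjugate data
  have key := hE3 L ι H dV hdV hdV0 t ht g hg hsig hpos h4 𝔣 μ e₁ lam' hlam' hw' (-a)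
    ⟨(Units.map ((starRingEnd ℂ : ℂ →+* ℂ) : ℂ →* ℂ)).comp χ.1,
      isAutomorphicOneChar_unitsMap_comp_chi (IsCMField.complexConj L) χ _⟩
    (ConjVec W) (repConj σ) hirr' hsm' j' hj' P.conj hP' hPσ'
  rw [hΦ', CMTypeOps.mem_bar_iff, exists_isAdmissibleElement_bar_locF_neg_iff] at key
  -- `e♮ ∉ Φ_λ ↔ adm(a)` gives `e♮ ∈ Φ_λ ↔ ¬ adm(a)`
  constructor
  · intro hmem hadm
    exact (key.mpr hadm) hmem
  · intro hnadm
    by_contra hmem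
    exact hnadm (key.mp hmem)

end Main

end Summit.HodgeConjecture.HodgeConjecture.Cruxes.HLiu418.E3AntiholOfHol

end
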